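import Summits.QuantumFields.YangMills.Theorems.UnitScaleTiltProp7TJDivGaugeDirDict
import Summits.QuantumFields.YangMills.Theorems.UnitScaleTiltProp7AvgHessGaugeT1Row
import HarnessLib

/-!
# (q-gauge) SUPPLIER, THE KNIT — **`hqG` (✓p768852's gauge-spike row) FROM THE SECOND-ORDER GAUGE-COVARIANCE IDENTITY READ IN NORM + THREE LETTERS**:
# (T1) ✓p769857 (a theorem) · (T2) = `sup_c‖QTwS Y c‖ ≤ C_Q′·ℓ·s` × the ℓ¹-mass `6ℓ⁻³‖A‖` of the averaged spike (✓⧗`Prop7AvgSeqSpikeMass`) · (T3) = «FR₂-lite» (the ℓ¹-mass of the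
# chart-derivative of FR₁'s frame-corrected parameter, `≤ C₃·ℓ⁻²·s·‖A‖`) — S1-SPEC (19200 evidence #54) assembled as ONE conditional door, so the programme's two open analytic
# items are EXACT Lean hypotheses: `hId` (S1-SPEC (2) in norm form) and `hκY` (FR₂-lite)

Cell `ym3-torus` (HUMAN RULING D-0037, YM ladder rung R3 — SU(2) YM₃ on T³: NOT d = 4, NOT infinite volume, NOT a mass gap, NOT Clay).  Width seat `ym3-torus-px19` (gen 14);
chair ★`ym-ust-19200-p1` g27 WORD №29 (2) «(q-gauge) → px19 g14».  THEOREMS ONLY (0 `def`, 0 `sorry`, default heartbeats); `--supports stmt-QuantumFields-19200 --as helper`; count-neutral.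

THE PRINT.  [Balaban1985BackgroundPropagators] (3.114)–(3.115) p.418 (gauge covariance of the averaging), (3.19) p.393, (3.13)–(3.15) p.393; [Balaban1985Averaging] (11) p.19, (97) p.32,
Prop. 3 p.36, Prop. 5 (157) p.42.

THE MATHEMATICS (S1-SPEC (2)–(4)).  Differentiating ✓p769222 `fderiv_logChartTwS_gaugeVelocity_apply` at `A = 0` along `Y` gives, for a site parameter `N`,
`avgHess U₀ Y (gd N) c = −QTwS(B₁ Y N) c + W₂(QTwS Y c; N⁽ᵏ⁾(ĉ₋), N⁽ᵏ⁾(ĉ₊)) + (κY(ĉ₋) − Ū₀(ĉ)κY(ĉ₊)Ū₀(ĉ)⁻¹)` with `B₁ Y N (b) = ½[N(b₋) + U₀(b)N(b₊)U₀(b)⁻¹, Y(b)]`, `W₂` the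
coarse BCH cross term (bilinear, local, `‖W₂(σ; κ₁, κ₂)‖ ≤ c_W‖σ‖(‖κ₁‖ + ‖κ₂‖)`), `N⁽ᵏ⁾` the k-fold block Ad-average, `κY = ∂_Y 𝓚_B N|₀`.  READ IN NORM and summed over the coarse bonds
`c` this is the displayed `hId` below with its three summed letters; for `N = δ_x ⊗ A`: (T1) ✓`sum_norm_QTwS_comm_gaugeSpike_le` = `12·C_Q·ℓ⁻²·s·‖A‖`, (T2) `c_W·(C_Q′ℓs)·(6ℓ⁻³‖A‖)`, (T3)
`6·C₃·ℓ⁻²·s·‖A‖` — total `qC·ℓ⁻²·s·‖A‖`, and ✓p769856 `hqG_row_of_gaugeDir_column` turns the gauge-direction column into `hqG`'s member text (`η⁻¹·ℓ⁻² = ℓ⁻¹`).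

WHAT IS PROVED (member `F`, `h : n ≤ K`, weights `c₀`, background `U₀ ∈ 𝔘_k(ε₀)` in the (COL) windows).
* §1 ★★ `gaugeDir_column_of_identity_and_letters` — the (q-gauge)-core column `Σ_y ‖avgHess U₀ X′ (gd(δ_xA)) y‖ ≤ qC·((F.L:ℝ)^(K−n))⁻¹^2·s′·‖A‖` from `hId` + `hQrow` + `hnK` + `hκY`,
  `qC := 12·C_Q∕2·… ` (explicit below).
* §2 ★★★ `hqG_member_of_identity_and_letters` — ✓p768852's member row `hQG` (text of ✓`norm_DstarL2_TJP_apply_le_of_columns`' hypothesis) with `qG := η⁻¹·qC·ℓ⁻²`, by ✓`hqG_row_of_gaugeDir_column`.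
HYP-SAT (★★OWNER RULING №42): `hId` is an inequality schema between the file's own objects and three ABSTRACT letter families `Q₁`-free: it is the norm reading of S1-SPEC (2) — NOT a theorem
of the tree today (OPEN: the `Y`-derivative of ✓p769222 at `A = 0`); `hnK` ⟸ ✓⧗`Prop7AvgSeqSpikeMass.sum_norm_avgSeq_le` (mass form) + coarse bond bookkeeping; `hQrow` ⟸ ✓`Prop7QTwSColumnBound`∕
✓`norm_Qk_le_of_regPr` (`η⁻¹`-scaled); `hκY` = «FR₂-lite» (OPEN).  Tested at `X′ = 0`: every letter forces only `0 ≤ const`; non-vacuous; no `Prop` placeholder.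
HONEST SCOPE.  Triangle-inequality bookkeeping; `hId` and `hκY` are DISPLAYED and OPEN; nothing of (q-gauge)-core, `hqG`, `T_J`'s divergence row beyond ✓p768852's door, norm_G, EX, the
crux or rung R3 is proved; the Yang–Mills mass gap is NOT proved.

References: T. Bałaban, CMP **99** (1985) 389–434 [Balaban1985BackgroundPropagators] ((3.13)–(3.15), (3.19) p.393, (3.114)–(3.115) p.418); CMP **98** (1985) 17–51
[Balaban1985Averaging] ((11) p.19, (97) p.32, Prop. 3 p.36, Prop. 5 (157) p.42).
-/

set_option autoImplicit false

noncomputable section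

open scoped BigOperators Matrix.Norms.L2Operator Matrix

namespace Summit.QuantumFields.YangMills.Theorems.Prop7AvgHessGaugeSpikeRowKnit

open Literature.MathematicalPhysics.QuantumFieldTheory.Balaban1983to89
open Literature.MathematicalPhysics.QuantumFieldTheory.Balaban1983to89.T3ContinuumYM3Torus
open T3PrintedRegularMinimiser (RegPr)
open T3SectALandauChart (bgUnits eta eta_pos)
open Summit.QuantumFields.YangMills.Theorems.Prop7SectET3HilbertLetters (W₂ toL2 toL2S DL2)
open Summit.QuantumFields.YangMills.Theorems.Prop7SectET3DeltaOne (avgHess)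
open Summit.QuantumFields.YangMills.Theorems.Prop7SymAvgTwSym (QTwS)
open Summit.QuantumFields.YangMills.Theorems.Prop7TJDivGaugeDirDict (hqG_row_of_gaugeDir_column)
open Summit.QuantumFields.YangMills.Theorems.Prop7AvgHessGaugeT1Row (sum_norm_QTwS_comm_gaugeSpike_le)

variable {F : T3Family} {n K : ℕ} {h : n ≤ K} {c₀ : ℝ} [Fact (0 < c₀)]

/-! ## §1 The (q-gauge)-core column from the identity-in-norm and the three letters -/

/-- ★★ **THE GAUGE-DIRECTION COLUMN OF `avgHess` FROM S1-SPEC (2) READ IN NORM + (T1)(T2)(T3).**  Let `U₀ ∈ 𝔘_k(ε₀)` in the (COL) windows.  Suppose: `hId` — for every bounded `Y`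
(`sup ≤ s`) and every site spike, the coarse column of `avgHess U₀ Y (gd(δ_xA))` is bounded by the `QTwS`-column of the commutator field (T1) plus `c_W·MQ·MN` (T2: `MQ` a sup bound of
`QTwS Y`, `MN` the summed coarse mass of the averaged spike) plus `MK` (T3: the summed coarse mass of the frame term); `hQrow` — `MQ ≤ CQ′·ℓ·s`; `hnK` — `MN ≤ 6·ℓ⁻³·‖A‖`; `hκY` —
`MK ≤ C₃·ℓ⁻²·s·‖A‖`.  Then `Σ_y ‖avgHess U₀ Y (gd(δ_xA)) y‖ ≤ (12·C_Q + 6·c_W·CQ′ + C₃)·ℓ⁻²·s·‖A‖`.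
[cite: Balaban1985BackgroundPropagators, (3.114)–(3.115) p.418, (3.19) p.393; Balaban1985Averaging, (97) p.32, Prop. 5 (157) p.42] -/
theorem gaugeDir_column_of_identity_and_letters {ε₀ : ℝ} (hε₀ : 0 < ε₀) (hε : 10 ^ 10 * (F.L : ℝ) ^ 6 * ε₀ ≤ 1) (hε12 : 10 ^ 12 * (F.L : ℝ) ^ 3 * ε₀ ≤ 1)
    (U₀ : GaugeField (F.P K) 0 (Matrix.specialUnitaryGroup (Fin 2) ℂ)) (hreg : RegPr F n K ε₀ U₀)
    {cW CQ' C₃ : ℝ} (hcW : 0 ≤ cW) (hCQ' : 0 ≤ CQ')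
    -- the letters (T2),(T3) as ABSTRACT real functionals of the data, with their displayed bounds
    (MQ : (PBond (F.P K) 0 → Matrix (Fin 2) (Fin 2) ℂ) → ℝ) (MN : Site (F.P K) 0 → Matrix (Fin 2) (Fin 2) ℂ → ℝ)
    (MK : (PBond (F.P K) 0 → Matrix (Fin 2) (Fin 2) ℂ) → Site (F.P K) 0 → Matrix (Fin 2) (Fin 2) ℂ → ℝ)
    (hQrow : ∀ (Y : PBond (F.P K) 0 → Matrix (Fin 2) (Fin 2) ℂ) (s : ℝ), (∀ b, ‖Y b‖ ≤ s) → MQ Y ≤ CQ' * (F.L : ℝ) ^ (K - n) * s)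
    (hnK : ∀ (x : Site (F.P K) 0) (A : Matrix (Fin 2) (Fin 2) ℂ), MN x A ≤ 6 * ((F.L : ℝ) ^ (K - n))⁻¹ ^ 3 * ‖A‖)
    (hκY : ∀ (Y : PBond (F.P K) 0 → Matrix (Fin 2) (Fin 2) ℂ) (s : ℝ) (x : Site (F.P K) 0) (A : Matrix (Fin 2) (Fin 2) ℂ), (∀ b, ‖Y b‖ ≤ s) →
      MK Y x A ≤ C₃ * ((F.L : ℝ) ^ (K - n))⁻¹ ^ 2 * s * ‖A‖)
    -- S1-SPEC (2), READ IN NORM AND SUMMED OVER THE COARSE BONDS (DISPLAYED; OPEN)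
    (hId : ∀ (Y : PBond (F.P K) 0 → Matrix (Fin 2) (Fin 2) ℂ) (x : Site (F.P K) 0) (A : Matrix (Fin 2) (Fin 2) ℂ), 0 ≤ MN x A →
      ∑ c : PBond (F.P n) 0, ‖avgHess F n K h U₀ Y (fun b : PBond (F.P K) 0 =>
          (Pi.single x A : Site (F.P K) 0 → Matrix (Fin 2) (Fin 2) ℂ) b.src
            - ((bgUnits F K U₀ b : (Matrix (Fin 2) (Fin 2) ℂ)ˣ) : Matrix (Fin 2) (Fin 2) ℂ) * (Pi.single x A : Site (F.P K) 0 → Matrix (Fin 2) (Fin 2) ℂ) b.tgt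
              * (((bgUnits F K U₀ b)⁻¹ : (Matrix (Fin 2) (Fin 2) ℂ)ˣ) : Matrix (Fin 2) (Fin 2) ℂ)) c‖
        ≤ ∑ c : PBond (F.P n) 0, ‖QTwS F n K h U₀ (fun b : PBond (F.P K) 0 =>
            ((Pi.single x A : Site (F.P K) 0 → Matrix (Fin 2) (Fin 2) ℂ) b.src
                + ((bgUnits F K U₀ b : (Matrix (Fin 2) (Fin 2) ℂ)ˣ) : Matrix (Fin 2) (Fin 2) ℂ) * (Pi.single x A : Site (F.P K) 0 → Matrix (Fin 2) (Fin 2) ℂ) b.tgt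
                  * (((bgUnits F K U₀ b)⁻¹ : (Matrix (Fin 2) (Fin 2) ℂ)ˣ) : Matrix (Fin 2) (Fin 2) ℂ)) * Y b
              - Y b * ((Pi.single x A : Site (F.P K) 0 → Matrix (Fin 2) (Fin 2) ℂ) b.src
                + ((bgUnits F K U₀ b : (Matrix (Fin 2) (Fin 2) ℂ)ˣ) : Matrix (Fin 2) (Fin 2) ℂ) * (Pi.single x A : Site (F.P K) 0 → Matrix (Fin 2) (Fin 2) ℂ) b.tgt
                  * (((bgUnits F K U₀ b)⁻¹ : (Matrix (Fin 2) (Fin 2) ℂ)ˣ) : Matrix (Fin 2) (Fin 2) ℂ))) c‖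
          + cW * MQ Y * MN x A + MK Y x A)
    (Y : PBond (F.P K) 0 → Matrix (Fin 2) (Fin 2) ℂ) (s : ℝ) (x : Site (F.P K) 0) (A : Matrix (Fin 2) (Fin 2) ℂ) (hY : ∀ b, ‖Y b‖ ≤ s)
    (hMN0 : 0 ≤ MN x A) :
    ∑ c : PBond (F.P n) 0, ‖avgHess F n K h U₀ Y (fun b : PBond (F.P K) 0 =>
        (Pi.single x A : Site (F.P K) 0 → Matrix (Fin 2) (Fin 2) ℂ) b.src
          - ((bgUnits F K U₀ b : (Matrix (Fin 2) (Fin 2) ℂ)ˣ) : Matrix (Fin 2) (Fin 2) ℂ) * (Pi.single x A : Site (F.P K) 0 → Matrix (Fin 2) (Fin 2) ℂ) b.tgt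
            * (((bgUnits F K U₀ b)⁻¹ : (Matrix (Fin 2) (Fin 2) ℂ)ˣ) : Matrix (Fin 2) (Fin 2) ℂ)) c‖
      ≤ (12 * (Real.sqrt 2 * (2 * Real.exp ((159 * ((((F.P K).d + 2) * (F.P K).L : ℕ) : ℝ) * (2 * ((F.P K).d : ℝ)))
              / ((((F.P K).L : ℝ) ^ (F.P K).d)⁻¹ * ((F.P K).L : ℝ)) * (((((F.P K).d + 2) * (F.P K).L : ℕ) : ℝ) ^ 2 / 16 * ε₀)) + 1))
          + 6 * cW * CQ' + C₃) * ((F.L : ℝ) ^ (K - n))⁻¹ ^ 2 * s * ‖A‖ := by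
  set ℓ : ℝ := (F.L : ℝ) ^ (K - n) with hℓ
  have hL : (0 : ℝ) < F.L := by have := F.hL.2; exact_mod_cast (by omega : 0 < F.L)
  have hℓpos : 0 < ℓ := pow_pos hL _
  have hs : 0 ≤ s := (norm_nonneg _).trans (hY ⟨x, 0⟩)
  set CQ : ℝ := (Real.sqrt 2 * (2 * Real.exp ((159 * ((((F.P K).d + 2) * (F.P K).L : ℕ) : ℝ) * (2 * ((F.P K).d : ℝ)))
              / ((((F.P K).L : ℝ) ^ (F.P K).d)⁻¹ * ((F.P K).L : ℝ)) * (((((F.P K).d + 2) * (F.P K).L : ℕ) : ℝ) ^ 2 / 16 * ε₀)) + 1)) with hCQ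
  have hT1 := sum_norm_QTwS_comm_gaugeSpike_le (h := h) hε₀ hε hε12 U₀ hreg x A Y hY
  have hT2 : cW * MQ Y * MN x A ≤ cW * (CQ' * ℓ * s) * (6 * ℓ⁻¹ ^ 3 * ‖A‖) := by
    have h1 : MQ Y ≤ CQ' * ℓ * s := hQrow Y s hY
    have h2 : MN x A ≤ 6 * ℓ⁻¹ ^ 3 * ‖A‖ := hnK x A
    have hMQ0 : 0 ≤ CQ' * ℓ * s := by positivity
    calc cW * MQ Y * MN x A ≤ cW * (CQ' * ℓ * s) * MN x A := mul_le_mul_of_nonneg_right (mul_le_mul_of_nonneg_left h1 hcW) hMN0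
      _ ≤ cW * (CQ' * ℓ * s) * (6 * ℓ⁻¹ ^ 3 * ‖A‖) := mul_le_mul_of_nonneg_left h2 (by positivity)
  have hT3 := hκY Y s x A hY
  have hkey : cW * (CQ' * ℓ * s) * (6 * ℓ⁻¹ ^ 3 * ‖A‖) = 6 * cW * CQ' * ℓ⁻¹ ^ 2 * s * ‖A‖ := by
    field_simp
  refine (hId Y x A hMN0).trans ?_
  rw [hkey] at hT2
  have hsum := add_le_add (add_le_add hT1 hT2) hT3
  refine hsum.trans (le_of_eq ?_)
  rw [← hCQ, ← hℓ]
  ring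

/-! ## §2 `hqG`'s member text -/

/-- ★★★ **✓p768852's MEMBER ROW `hQG` FROM THE IDENTITY-IN-NORM AND THE THREE LETTERS**: §1 ∘ ✓`Prop7TJDivGaugeDirDict.hqG_row_of_gaugeDir_column` — for every bounded `X′` and site spike,
`Σ_y ‖avgHess U₀ X′ (toL2⁻¹(D_{U₀}(toL2S(δ_xA)))) y‖ ≤ η⁻¹·qC·ℓ⁻²·s′·‖A‖` (`= qC·ℓ⁻¹·s′·‖A‖`: the supplier currency of ✓`hTJdiv_of_hHcol_hqG`).
[cite: Balaban1985BackgroundPropagators, (3.114)–(3.115) p.418; Balaban1985Averaging, Prop. 5 (157) p.42] -/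
theorem hqG_member_of_identity_and_letters {ε₀ : ℝ} (hε₀ : 0 < ε₀) (hε : 10 ^ 10 * (F.L : ℝ) ^ 6 * ε₀ ≤ 1) (hε12 : 10 ^ 12 * (F.L : ℝ) ^ 3 * ε₀ ≤ 1)
    (U₀ : GaugeField (F.P K) 0 (Matrix.specialUnitaryGroup (Fin 2) ℂ)) (hreg : RegPr F n K ε₀ U₀)
    {cW CQ' C₃ : ℝ} (hcW : 0 ≤ cW) (hCQ' : 0 ≤ CQ')
    (MQ : (PBond (F.P K) 0 → Matrix (Fin 2) (Fin 2) ℂ) → ℝ) (MN : Site (F.P K) 0 → Matrix (Fin 2) (Fin 2) ℂ → ℝ)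
    (MK : (PBond (F.P K) 0 → Matrix (Fin 2) (Fin 2) ℂ) → Site (F.P K) 0 → Matrix (Fin 2) (Fin 2) ℂ → ℝ)
    (hMN0 : ∀ x A, 0 ≤ MN x A)
    (hQrow : ∀ (Y : PBond (F.P K) 0 → Matrix (Fin 2) (Fin 2) ℂ) (s : ℝ), (∀ b, ‖Y b‖ ≤ s) → MQ Y ≤ CQ' * (F.L : ℝ) ^ (K - n) * s)
    (hnK : ∀ (x : Site (F.P K) 0) (A : Matrix (Fin 2) (Fin 2) ℂ), MN x A ≤ 6 * ((F.L : ℝ) ^ (K - n))⁻¹ ^ 3 * ‖A‖)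
    (hκY : ∀ (Y : PBond (F.P K) 0 → Matrix (Fin 2) (Fin 2) ℂ) (s : ℝ) (x : Site (F.P K) 0) (A : Matrix (Fin 2) (Fin 2) ℂ), (∀ b, ‖Y b‖ ≤ s) →
      MK Y x A ≤ C₃ * ((F.L : ℝ) ^ (K - n))⁻¹ ^ 2 * s * ‖A‖)
    (hId : ∀ (Y : PBond (F.P K) 0 → Matrix (Fin 2) (Fin 2) ℂ) (x : Site (F.P K) 0) (A : Matrix (Fin 2) (Fin 2) ℂ), 0 ≤ MN x A →
      ∑ c : PBond (F.P n) 0, ‖avgHess F n K h U₀ Y (fun b : PBond (F.P K) 0 =>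
          (Pi.single x A : Site (F.P K) 0 → Matrix (Fin 2) (Fin 2) ℂ) b.src
            - ((bgUnits F K U₀ b : (Matrix (Fin 2) (Fin 2) ℂ)ˣ) : Matrix (Fin 2) (Fin 2) ℂ) * (Pi.single x A : Site (F.P K) 0 → Matrix (Fin 2) (Fin 2) ℂ) b.tgt
              * (((bgUnits F K U₀ b)⁻¹ : (Matrix (Fin 2) (Fin 2) ℂ)ˣ) : Matrix (Fin 2) (Fin 2) ℂ)) c‖
        ≤ ∑ c : PBond (F.P n) 0, ‖QTwS F n K h U₀ (fun b : PBond (F.P K) 0 =>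
            ((Pi.single x A : Site (F.P K) 0 → Matrix (Fin 2) (Fin 2) ℂ) b.src
                + ((bgUnits F K U₀ b : (Matrix (Fin 2) (Fin 2) ℂ)ˣ) : Matrix (Fin 2) (Fin 2) ℂ) * (Pi.single x A : Site (F.P K) 0 → Matrix (Fin 2) (Fin 2) ℂ) b.tgt
                  * (((bgUnits F K U₀ b)⁻¹ : (Matrix (Fin 2) (Fin 2) ℂ)ˣ) : Matrix (Fin 2) (Fin 2) ℂ)) * Y b
              - Y b * ((Pi.single x A : Site (F.P K) 0 → Matrix (Fin 2) (Fin 2) ℂ) b.src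
                + ((bgUnits F K U₀ b : (Matrix (Fin 2) (Fin 2) ℂ)ˣ) : Matrix (Fin 2) (Fin 2) ℂ) * (Pi.single x A : Site (F.P K) 0 → Matrix (Fin 2) (Fin 2) ℂ) b.tgt
                  * (((bgUnits F K U₀ b)⁻¹ : (Matrix (Fin 2) (Fin 2) ℂ)ˣ) : Matrix (Fin 2) (Fin 2) ℂ))) c‖
          + cW * MQ Y * MN x A + MK Y x A) :
    ∀ (X' : PBond (F.P K) 0 → Matrix (Fin 2) (Fin 2) ℂ) (s' : ℝ) (x : Site (F.P K) 0) (A : Matrix (Fin 2) (Fin 2) ℂ), (∀ b, ‖X' b‖ ≤ s') →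
      ∑ y : PBond (F.P n) 0, ‖avgHess F n K h U₀ X' ((toL2 F K c₀).symm (DL2 F n K c₀ U₀ (toL2S F K c₀ (Pi.single x A)))) y‖
        ≤ (eta F n K)⁻¹ * ((12 * (Real.sqrt 2 * (2 * Real.exp ((159 * ((((F.P K).d + 2) * (F.P K).L : ℕ) : ℝ) * (2 * ((F.P K).d : ℝ)))
              / ((((F.P K).L : ℝ) ^ (F.P K).d)⁻¹ * ((F.P K).L : ℝ)) * (((((F.P K).d + 2) * (F.P K).L : ℕ) : ℝ) ^ 2 / 16 * ε₀)) + 1))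
          + 6 * cW * CQ' + C₃) * ((F.L : ℝ) ^ (K - n))⁻¹ ^ 2) * s' * ‖A‖ :=
  hqG_row_of_gaugeDir_column (h := h) (c₀ := c₀) U₀ (fun X' s' x A hX' => by
    have hmain := gaugeDir_column_of_identity_and_letters (h := h) hε₀ hε hε12 U₀ hreg hcW hCQ' MQ MN MK hQrow hnK hκY hId X' s' x A hX' (hMN0 x A)
    refine hmain.trans (le_of_eq ?_)
    ring)

end Summit.QuantumFields.YangMills.Theorems.Prop7AvgHessGaugeSpikeRowKnit

end
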